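import Summits.BirchSwinnertonDyer.BirchSwinnertonDyer.Theorems.GenusKolyvaginAtTwoEquivariantKolyvaginExactAtTwoEigenClassesFinite
import HarnessLib

/-!
# Route `GenusKolyvaginAtTwo`, LINE 18 (L_T `PowDvdShaCardAtTwoRT`, stmt-BirchSwinnertonDyer-23242), stub L
# `stub_twinShaLaddersAtTwo` — THE DESCENT LAYER (1/2): a rung of the ℚ-side ladder from a family of `τ`-FIXED classes over `K`

Seat `bsd-line-gk2-p2` g18 (PROVER seat 2/3, cell `bsd-f1-sign2`), `--supports stmt-BirchSwinnertonDyer-23242` (helper; closes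
nothing). THEOREMS ONLY (no definition, no named fact, no `sorry`); BSD is not proved by any of this.

WHY. Stub L asks, rung by rung, for families `x : Fin s → H¹(ℚ, W)` (and `y : Fin s → H¹(ℚ, Wd)` for the twin) of prescribed
`2`-power order, independent modulo that order, whose restrictions to `K` lie in `Ш(W_K/K)` (resp. `Ш(Wd_K/K)`) — the binders
`hfam` / `hfam'` of gk2-p3's frame theorem `two_mul_le_padicValNat_add_of_shaLadders`. Kolyvagin's classes
`d_{M_{r−1}}(n) = 2^{L − M_{r−1}} c_L(n)` live OVER `K`, in `H¹(K, E_K[2^L])`: they are SELMER (McCallum Lemma 4.3 + Prop. 4.4 +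
minimality), `τ`-EIGEN with the sign of the depth (Gross Prop. 5.4, tree `sign_conjAct_kolyvaginClass_two`), of order `2^{M_{r−1}−M_r}`
and independent (Prop. 5.2). This file is the passage from such a K-side family to L's ℚ-side family on the `τ = +1` side, for ANY
`X/ℚ` and any quadratic `K` with `X(K)[n] = 0`:

* §0 `sum_zsmul_map_eq_zero_iff_of_injOn_span`, `addOrderOf_eq_of_forall_sum_zsmul_eq_zero_iff`,
  `indep_of_forall_sum_zsmul_eq_zero_iff` — transfer of orders / independence along a relation-preserving correspondence.
* §1 **`exists_galH1Family_of_conjAct_eq`** — `z : Fin s → H¹(K, X_K[n])` with `σ₀·z_i = z_i` descend UNIQUELY to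
  `x̃_i ∈ H¹(ℚ, X[n])` (gk2-p3 `EigenClassesFinite.existsUnique_resTorsion_eq_of_conjAct_eq`), and `x_i :=` the image of `x̃_i` in
  `H¹(ℚ, X)` satisfies `res_K x_i = ι z_i` (`ι : H¹(K, X_K[n]) → H¹(K, X_K)`, naturality `torsionH1ToH1_resTorsion`); if the K-SPAN
  of `z` meets `ker ι = δ(X(K)/n)` trivially (McCallum's «`⟨c⟩ ∩ ⟨δ E(K)⟩ = 0`»), then `∑ e_i x_i = 0 ↔ ∑ e_i z_i = 0` for all
  integer vectors `e` — so orders and independence are those of `z`;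
  **`exists_galH1Family_of_conjAct_eq_of_injective`** — the same when instead `H¹(ℚ, X[n]) → H¹(ℚ, X)` is injective (rank-`0`
  side: `X(ℚ)` finite of odd order, gk2-p1 `torsionH1ToH1_injective_of_divisible` +
  `exists_zsmul_two_pow_eq_of_rank_zero_of_odd_torsionOrder`), with NO condition over `K`.
* §2 **`exists_shaFamily_of_fixed_selmerFamily(_of_injective)`** — L's `hfam` shape VERBATIM at one rung: Selmer + fixed +
  orders `2^a` + independence mod `2^a` over `K` ⟹ `∃ x : Fin s → X.galH1`, `resBaseChange X K (x i) ∈ (X.baseChange K).sha`,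
  `addOrderOf (x i) = 2^a`, independence (`selmerGroup_eq_comap_sha`); `σ ≠ 1` arbitrary (`eq_sigmaQ_of_ne_one`).
The `τ = −1` side (twin `Wd`) is the sibling file `…RTRungDescentTwin`.

References: [GrossLMS1991] §5 (5.1), Prop. 5.4; [McCallumLMS1991] §5 Prop. 5.2, Thm. 5.4 (p. 310); [SilvermanAEC2009] X.§4;
[SerreGaloisCohomology1997] I.§2.6 (b).
-/

set_option autoImplicit false
-- the Theorems namespace of this sub repeats the summit name by design (D-0017 nested layout)
set_option linter.dupNamespace false

noncomputable section

open scoped Classical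

namespace Summit.BirchSwinnertonDyer.BirchSwinnertonDyer.Theorems.GenusExact.PlusDescent

open WeierstrassCurve NumberField Field Literature.NumberTheory.EllipticCurves
  Literature.NumberTheory.GaloisRepresentations Literature.NumberTheory.QuadraticFields

/-! ## §0 Transfer of relations, orders and independence -/

section Transfer

variable {A B : Type*} [AddCommGroup A] [AddCommGroup B]

/-- Along a homomorphism injective on the span of a family, integer relations among the images are exactly the relations among
the family. [folklore] -/
theorem sum_zsmul_map_eq_zero_iff_of_injOn_span (f : A →+ B) {s : ℕ} (x : Fin s → A)
    (hinj : ∀ e : Fin s → ℤ, f (∑ i, e i • x i) = 0 → ∑ i, e i • x i = 0) (e : Fin s → ℤ) :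
    ∑ i, e i • f (x i) = 0 ↔ ∑ i, e i • x i = 0 := by
  have hsum : ∑ i, e i • f (x i) = f (∑ i, e i • x i) := by
    rw [map_sum]
    simp only [map_zsmul]
  rw [hsum]
  exact ⟨hinj e, fun h ↦ by rw [h, map_zero]⟩

/-- Two families with the same integer relations have the same orders. [folklore] -/
theorem addOrderOf_eq_of_forall_sum_zsmul_eq_zero_iff {s : ℕ} (x : Fin s → A) (y : Fin s → B)
    (h : ∀ e : Fin s → ℤ, ∑ i, e i • x i = 0 ↔ ∑ i, e i • y i = 0) (i : Fin s) :
    addOrderOf (x i) = addOrderOf (y i) := by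
  rw [addOrderOf_eq_addOrderOf_iff]
  intro k
  have hk := h (fun j ↦ if j = i then (k : ℤ) else 0)
  simpa only [ite_smul, zero_smul, Finset.sum_ite_eq', Finset.mem_univ, if_true, natCast_zsmul] using hk

/-- Two families with the same integer relations are independent modulo `N` together. [folklore] -/
theorem indep_of_forall_sum_zsmul_eq_zero_iff {s : ℕ} (x : Fin s → A) (y : Fin s → B)
    (h : ∀ e : Fin s → ℤ, ∑ i, e i • x i = 0 ↔ ∑ i, e i • y i = 0) {N : ℤ}
    (hind : ∀ e : Fin s → ℤ, ∑ i, e i • y i = 0 → ∀ i, N ∣ e i) :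
    ∀ e : Fin s → ℤ, ∑ i, e i • x i = 0 → ∀ i, N ∣ e i :=
  fun e he ↦ hind e ((h e).mp he)

end Transfer

/-! ## §1 Descent of a `τ`-fixed family of `H¹(K, X_K[n])` to `H¹(ℚ, X)` -/

section Fixed

variable (X : WeierstrassCurve ℚ) (K : Type) [Field K] [NumberField K]
  (h2 : Module.finrank ℚ K = 2) {θ : K} {c : ℚ} (hθ : θ ∉ Set.range (algebraMap ℚ K))
  (hc : θ ^ 2 = algebraMap ℚ K c) (n : ℤ)

/-- **Descent of a `τ`-fixed family, with the Kummer condition over `K`.** `K = ℚ(θ)`, `θ² = c`, `σ₀` its conjugation, `X/ℚ`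
with `X(K)[n] = 0`. Classes `z_i ∈ H¹(K, X_K[n])` fixed by `σ₀` are `res x̃_i` for unique `x̃_i ∈ H¹(ℚ, X[n])`; with `x_i` the image
of `x̃_i` in `H¹(ℚ, X)`: `res_K x_i = ι z_i`, and if the span of `z` meets `ker(ι : H¹(K, X_K[n]) → H¹(K, X_K))` trivially then the
integer relations of `x` are exactly those of `z`. [cite: GrossLMS1991, §5 (5.1)] [cite: McCallumLMS1991, §5 Prop. 5.2] -/
theorem exists_galH1Family_of_conjAct_eq
    (hL : ∀ P : (X.baseChange K).toAffine.Point, n • P = 0 → P = 0)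
    {s : ℕ} (z : Fin s → galH1Torsion (X.baseChange K) n)
    (hfix : ∀ i, conjAct X (sigmaQ K h2 hθ hc) n (z i) = z i)
    (hker : ∀ e : Fin s → ℤ, torsionH1ToH1 (X.baseChange K) n (∑ i, e i • z i) = 0 → ∑ i, e i • z i = 0) :
    ∃ x : Fin s → X.galH1,
      (∀ i, resBaseChange X K (x i) = torsionH1ToH1 (X.baseChange K) n (z i)) ∧
      ∀ e : Fin s → ℤ, ∑ i, e i • x i = 0 ↔ ∑ i, e i • z i = 0 := by
  have hdesc : ∀ i, ∃ xt : galH1Torsion X n, resTorsion X K n xt = z i := fun i ↦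
    (EigenClassesFinite.existsUnique_resTorsion_eq_of_conjAct_eq X K h2 hθ hc n hL (hfix i)).exists
  choose xt hxt using hdesc
  have hinjres := EigenClassesFinite.resTorsion_injective_of_noTorsion X K h2 hθ hc n hL
  have hsumz : ∀ e : Fin s → ℤ, ∑ i, e i • z i = resTorsion X K n (∑ i, e i • xt i) := fun e ↦ by
    rw [map_sum]
    simp only [map_zsmul, hxt]
  refine ⟨fun i ↦ torsionH1ToH1 X n (xt i), fun i ↦ ?_, fun e ↦ ⟨fun h ↦ ?_, fun h ↦ ?_⟩⟩
  · rw [← torsionH1ToH1_resTorsion, hxt]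
  · -- restrict the relation to `K`: it becomes a relation among the `ι z_i`, i.e. `ι (∑ e_i z_i) = 0`
    have h1 : resBaseChange X K (∑ i, e i • torsionH1ToH1 X n (xt i)) = 0 := by rw [h, map_zero]
    rw [map_sum] at h1
    simp only [map_zsmul, ← torsionH1ToH1_resTorsion, hxt] at h1
    refine hker e ?_
    rw [map_sum]
    simpa only [map_zsmul] using h1
  · rw [hsumz] at h
    have h0 : ∑ i, e i • xt i = 0 := hinjres (by rw [h, map_zero])
    have h1 := congrArg (torsionH1ToH1 X n) h0
    rw [map_sum, map_zero] at h1
    simpa only [map_zsmul] using h1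

/-- **Descent of a `τ`-fixed family, with the Kummer condition over `ℚ`.** As `exists_galH1Family_of_conjAct_eq`, but assuming
instead that `H¹(ℚ, X[n]) → H¹(ℚ, X)` is injective (`X(ℚ)/nX(ℚ) = 0`: the rank-`0` member of the ℚ-pair with odd torsion order —
`torsionH1ToH1_injective_of_divisible` + `exists_zsmul_two_pow_eq_of_rank_zero_of_odd_torsionOrder`); then NO condition on the
span over `K` is needed. [cite: GrossLMS1991, §5 (5.1)] [cite: McCallumLMS1991, §5 Thm. 5.4] -/
theorem exists_galH1Family_of_conjAct_eq_of_injective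
    (hL : ∀ P : (X.baseChange K).toAffine.Point, n • P = 0 → P = 0)
    (hinjQ : Function.Injective (torsionH1ToH1 X n))
    {s : ℕ} (z : Fin s → galH1Torsion (X.baseChange K) n)
    (hfix : ∀ i, conjAct X (sigmaQ K h2 hθ hc) n (z i) = z i) :
    ∃ x : Fin s → X.galH1,
      (∀ i, resBaseChange X K (x i) = torsionH1ToH1 (X.baseChange K) n (z i)) ∧
      ∀ e : Fin s → ℤ, ∑ i, e i • x i = 0 ↔ ∑ i, e i • z i = 0 := by
  have hdesc : ∀ i, ∃ xt : galH1Torsion X n, resTorsion X K n xt = z i := fun i ↦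
    (EigenClassesFinite.existsUnique_resTorsion_eq_of_conjAct_eq X K h2 hθ hc n hL (hfix i)).exists
  choose xt hxt using hdesc
  have hinjres := EigenClassesFinite.resTorsion_injective_of_noTorsion X K h2 hθ hc n hL
  -- relations of `xt` are those of `z` (`res` injective) and those of `x` (`ι` injective over `ℚ`)
  have hz : ∀ e : Fin s → ℤ, ∑ i, e i • z i = 0 ↔ ∑ i, e i • xt i = 0 := fun e ↦ by
    have h := sum_zsmul_map_eq_zero_iff_of_injOn_span (resTorsion X K n) xt
      (fun e' he' ↦ hinjres (by rw [he', map_zero])) e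
    simpa only [hxt] using h
  refine ⟨fun i ↦ torsionH1ToH1 X n (xt i), fun i ↦ ?_, fun e ↦ ?_⟩
  · rw [← torsionH1ToH1_resTorsion, hxt]
  · rw [hz]
    exact sum_zsmul_map_eq_zero_iff_of_injOn_span (torsionH1ToH1 X n) xt (fun e' he' ↦ hinjQ (by rw [he', map_zero])) e

end Fixed

/-! ## §2 L's `hfam` shape at one rung: Selmer + fixed + orders + independence over `K` ⟹ the ℚ-side family -/

section Rung

variable (X : WeierstrassCurve ℚ) (K : Type) [Field K] [NumberField K]
  (h2 : Module.finrank ℚ K = 2) (σ : K ≃ₐ[ℚ] K) (hσ : σ ≠ 1) (n : ℤ)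

include h2 hσ in
/-- **ONE RUNG OF L's `W`-LADDER FROM KOLYVAGIN'S K-CLASSES (Kummer condition over `K`).** `K` quadratic, `σ ≠ 1` in `Aut(K/ℚ)`,
`X/ℚ` with `X(K)[n] = 0`; `z : Fin s → H¹(K, X_K[n])` SELMER, `σ`-FIXED, of order `2^a`, independent modulo `2^a`, whose span meets
`ker(H¹(K, X_K[n]) → H¹(K, X_K))` (the Kummer image of `X(K)/n`) trivially. Then there are `x : Fin s → H¹(ℚ, X)` with
`res_K x_i ∈ Ш(X_K/K)`, `ord x_i = 2^a`, independent modulo `2^a` — the binder `hfam` of stub L / of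
`two_mul_le_padicValNat_add_of_shaLadders` at this rung. [cite: McCallumLMS1991, §5 Prop. 5.2, Thm. 5.4 (p. 310)]
[cite: GrossLMS1991, §5 (5.1)] -/
theorem exists_shaFamily_of_fixed_selmerFamily
    (hL : ∀ P : (X.baseChange K).toAffine.Point, n • P = 0 → P = 0)
    {s a : ℕ} (z : Fin s → galH1Torsion (X.baseChange K) n)
    (hsel : ∀ i, z i ∈ selmerGroup (X.baseChange K) n)
    (hfix : ∀ i, conjAct X σ n (z i) = z i)
    (hker : ∀ e : Fin s → ℤ, torsionH1ToH1 (X.baseChange K) n (∑ i, e i • z i) = 0 → ∑ i, e i • z i = 0)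
    (hord : ∀ i, addOrderOf (z i) = 2 ^ a)
    (hind : ∀ e : Fin s → ℤ, ∑ i, e i • z i = 0 → ∀ i, ((2 ^ a : ℕ) : ℤ) ∣ e i) :
    ∃ x : Fin s → X.galH1, (∀ i, resBaseChange X K (x i) ∈ (X.baseChange K).sha) ∧
      (∀ i, addOrderOf (x i) = 2 ^ a) ∧
      ∀ e : Fin s → ℤ, ∑ i, e i • x i = 0 → ∀ i, ((2 ^ a : ℕ) : ℤ) ∣ e i := by
  obtain ⟨θ, c, hθ, hc⟩ := Quadratic.exists_sq_eq_algebraMap (F := ℚ) (K := K) h2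
  have hσ' : σ = sigmaQ K h2 hθ hc := eq_sigmaQ_of_ne_one K h2 σ hσ hθ hc
  subst hσ'
  obtain ⟨x, hres, hrel⟩ := exists_galH1Family_of_conjAct_eq X K h2 hθ hc n hL z hfix hker
  refine ⟨x, fun i ↦ ?_, fun i ↦ (addOrderOf_eq_of_forall_sum_zsmul_eq_zero_iff x z hrel i).trans (hord i),
    indep_of_forall_sum_zsmul_eq_zero_iff x z hrel hind⟩
  have h := hsel i
  rw [selmerGroup_eq_comap_sha, AddSubgroup.mem_comap] at h
  rw [hres i]
  exact h

include h2 hσ in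
/-- **ONE RUNG OF L's `W`-LADDER FROM KOLYVAGIN'S K-CLASSES (rank-`0` side: Kummer condition over `ℚ`).** As
`exists_shaFamily_of_fixed_selmerFamily`, with the span condition over `K` replaced by the injectivity of
`H¹(ℚ, X[n]) → H¹(ℚ, X)` — automatic when `X(ℚ)` is finite of odd order (the curve `W` of L_T: rank `0` by Kolyvagin, odd torsion by
`ρ̄_{E,2}` onto). [cite: McCallumLMS1991, §5 Thm. 5.4 (p. 310)] [cite: GrossLMS1991, §5 (5.1)] -/
theorem exists_shaFamily_of_fixed_selmerFamily_of_injective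
    (hL : ∀ P : (X.baseChange K).toAffine.Point, n • P = 0 → P = 0)
    (hinjQ : Function.Injective (torsionH1ToH1 X n))
    {s a : ℕ} (z : Fin s → galH1Torsion (X.baseChange K) n)
    (hsel : ∀ i, z i ∈ selmerGroup (X.baseChange K) n)
    (hfix : ∀ i, conjAct X σ n (z i) = z i)
    (hord : ∀ i, addOrderOf (z i) = 2 ^ a)
    (hind : ∀ e : Fin s → ℤ, ∑ i, e i • z i = 0 → ∀ i, ((2 ^ a : ℕ) : ℤ) ∣ e i) :
    ∃ x : Fin s → X.galH1, (∀ i, resBaseChange X K (x i) ∈ (X.baseChange K).sha) ∧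
      (∀ i, addOrderOf (x i) = 2 ^ a) ∧
      ∀ e : Fin s → ℤ, ∑ i, e i • x i = 0 → ∀ i, ((2 ^ a : ℕ) : ℤ) ∣ e i := by
  obtain ⟨θ, c, hθ, hc⟩ := Quadratic.exists_sq_eq_algebraMap (F := ℚ) (K := K) h2
  have hσ' : σ = sigmaQ K h2 hθ hc := eq_sigmaQ_of_ne_one K h2 σ hσ hθ hc
  subst hσ'
  obtain ⟨x, hres, hrel⟩ := exists_galH1Family_of_conjAct_eq_of_injective X K h2 hθ hc n hL hinjQ z hfix
  refine ⟨x, fun i ↦ ?_, fun i ↦ (addOrderOf_eq_of_forall_sum_zsmul_eq_zero_iff x z hrel i).trans (hord i),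
    indep_of_forall_sum_zsmul_eq_zero_iff x z hrel hind⟩
  have h := hsel i
  rw [selmerGroup_eq_comap_sha, AddSubgroup.mem_comap] at h
  rw [hres i]
  exact h

end Rung

end Summit.BirchSwinnertonDyer.BirchSwinnertonDyer.Theorems.GenusExact.PlusDescent

end
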